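import Literature.NumberTheory.LFunctions.RealCharacterSmoothSums
import Literature.NumberTheory.LFunctions.ExceptionalPrimesHyperbola
import HarnessLib

/-!
# `L(1, χ)` is small at the scale of an exceptional zero:
# `L(1,χ) ≤ (1−β) ∑_{n ≤ N} r(n)/n + 10q/⌊√N⌋` when `L(β, χ) = 0`

Topic `Literature/NumberTheory/LFunctions`. Everything is PROVED. Let `χ` be a quadratic
Dirichlet character mod `q`, `χ ≠ χ₀`, let `0 < β < 1` be a real zero of `L(s, χ)`, write
`r = χ ∗ 1 ≥ 0`, and let `N ≥ 1`, `D = ⌊√N⌋`. The tree's hyperbola estimate AT THE ZERO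
(`Literature.NumberTheory.LFunctions.SiegelZero.abs_sum_re_zetaMul_mul_rpow_sub_main_le`,
`ExceptionalPrimesHyperbola.lean`):

  `|∑_{n ≤ N} r(n) n^{-β} − (N^{1−β}/(1−β)) ∑_{d ≤ D} χ(d)/d| ≤ 2 D^{-β} ((q+1) A(D) + q/(1−β))`,
  `A(D) = ∑_{e ≤ D} e^{-β} ≤ D^{1−β}/(1−β)`,

is turned here into an upper bound for `L(1, χ)`: since `r ≥ 0` and `n^{-β} ≤ N^{1−β}/n`
(`n ≤ N`), `∑_{n ≤ N} r(n) n^{-β} ≤ N^{1−β} ∑_{n ≤ N} r(n)/n`; dividing by `N^{1−β}/(1−β)` and using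
`D^{1−2β} N^{β−1} ≤ 1/D`, `D^{−β} N^{β−1} ≤ 1/D` (`D² ≤ N`) the error becomes `≤ 8q/D`; finally
`∑_{d ≤ D} χ(d)/d ≥ L(1,χ) − 2q/D` (`RealCharacterPartialSums.lean`). Hence

* `RealChar.re_LFunction_one_le_of_zero` — **`L(1, χ) ≤ (1 − β) ∑_{n ≤ N} r(n)/n + 10 q/⌊√N⌋`**;
* `RealChar.re_LFunction_one_le_prod_of_zero` — with the smooth-number majorant
  `∑_{n ≤ N} r(n)/n ≤ ∏_{p ≤ N} ((1−1/p)(1−χ(p)/p))⁻¹` (`RealChar.sum_charDivisorSum_div_le_prod`):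
  `L(1, χ) ≤ (1 − β) ∏_{p ≤ N} ((1−1/p)(1−χ(p)/p))⁻¹ + 10 q/⌊√N⌋`.

With `β = 1 − 1/(η log q)` and `N = q⁴` the right side is `≍ (4/η) ∏_{p ≤ q⁴}(1 − χ(p)/p)⁻¹ + 10/q`:
this is the quantitative form of "an exceptional zero forces `χ(p) = −1` for most small primes"
which replaces, in this tree, the explicit-formula route of Granville–Mollin (*Rabinowitsch
revisited*, Acta Arith. 96 (2000), §3 (3.1)–(3.3), §5C) to the sparsity of the primes with
`χ(p) = 1` (compare Tao–Teräväinen 2021, Prop. 3.5).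

## References

* H. Davenport, *Multiplicative Number Theory*, 2nd ed., GTM 74 (1980), Ch. 14.
  [DavenportMNT1980]
* A. Granville, R. A. Mollin, *Rabinowitsch revisited*, Acta Arith. 96 (2000), §5C.
  [GranvilleMollin2000]
* T. Tao, J. Teräväinen, *The Hardy–Littlewood–Chowla conjecture in the presence of a Siegel
  zero*, J. London Math. Soc. 106 (2022), §3.3, Proposition 3.5. [TaoTeravainen2021]
-/

noncomputable section

open Finset ArithmeticFunction
open scoped ArithmeticFunction.zeta

namespace Literature.NumberTheory.LFunctions.RealChar

open DirichletAbel PowerSum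

variable {q : ℕ} [NeZero q] (χ : DirichletCharacter ℂ q)

/-! ### Two exponent inequalities for `D = ⌊√N⌋` -/

/-- `D^{1−2β} N^{β−1} ≤ 1/D` when `D² ≤ N`, `0 < D`, `β ≤ 1`. [folklore] -/
theorem rpow_one_sub_two_mul_mul_rpow_le {D N β : ℝ} (hD : 0 < D) (hDN : D ^ 2 ≤ N) (hβ1 : β ≤ 1) :
    D ^ (1 - 2 * β) * N ^ (β - 1) ≤ D⁻¹ := by
  have hN : 0 < N := lt_of_lt_of_le (by positivity) hDN
  have h1 : D ^ (1 - 2 * β) = (D ^ 2) ^ (1 - β) * D⁻¹ := by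
    rw [← Real.rpow_natCast D 2, ← Real.rpow_mul hD.le, ← Real.rpow_neg_one, ← Real.rpow_add hD]
    norm_num
    ring_nf
  have h2 : (D ^ 2) ^ (1 - β) ≤ N ^ (1 - β) := Real.rpow_le_rpow (by positivity) hDN (by linarith)
  have h3 : N ^ (1 - β) * N ^ (β - 1) = 1 := by
    rw [← Real.rpow_add hN]; norm_num
  calc D ^ (1 - 2 * β) * N ^ (β - 1) = (D ^ 2) ^ (1 - β) * D⁻¹ * N ^ (β - 1) := by rw [h1]
    _ ≤ N ^ (1 - β) * D⁻¹ * N ^ (β - 1) := by gcongr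
    _ = D⁻¹ * (N ^ (1 - β) * N ^ (β - 1)) := by ring
    _ = D⁻¹ := by rw [h3, mul_one]

/-- `D^{−β} N^{β−1} ≤ 1/D` when `D ≤ N`, `0 < D`, `β ≤ 1`. [folklore] -/
theorem rpow_neg_mul_rpow_le {D N β : ℝ} (hD : 0 < D) (hDN : D ≤ N) (hβ1 : β ≤ 1) :
    D ^ (-β) * N ^ (β - 1) ≤ D⁻¹ := by
  have hN : 0 < N := lt_of_lt_of_le hD hDN
  have h1 : D ^ (-β) = D ^ (1 - β) * D⁻¹ := by
    rw [← Real.rpow_neg_one, ← Real.rpow_add hD]; ring_nf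
  have h2 : D ^ (1 - β) ≤ N ^ (1 - β) := Real.rpow_le_rpow hD.le hDN (by linarith)
  have h3 : N ^ (1 - β) * N ^ (β - 1) = 1 := by
    rw [← Real.rpow_add hN]; norm_num
  calc D ^ (-β) * N ^ (β - 1) = D ^ (1 - β) * D⁻¹ * N ^ (β - 1) := by rw [h1]
    _ ≤ N ^ (1 - β) * D⁻¹ * N ^ (β - 1) := by gcongr
    _ = D⁻¹ * (N ^ (1 - β) * N ^ (β - 1)) := by ring
    _ = D⁻¹ := by rw [h3, mul_one]

/-! ### The main inequality -/

/-- **`L(1, χ)` at the scale of an exceptional zero.** Let `χ ≠ χ₀` be a quadratic character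
mod `q`, `0 < β < 1` with `L(β, χ) = 0`, and `N ≥ 1` an integer, `D = ⌊√N⌋`. Then
`L(1, χ) ≤ (1 − β) ∑_{n ≤ N} r(n)/n + 10 q / D`, where `r = χ ∗ 1` (from the tree's hyperbola
estimate at the zero, see the module docstring). [cite: DavenportMNT1980, Ch. 14] -/
theorem re_LFunction_one_le_of_zero (hχ : χ ≠ 1) (hq : χ ^ 2 = 1) {β : ℝ} (hβ0 : 0 < β)
    (hβ1 : β < 1) (hzero : χ.LFunction β = 0) {N : ℕ} (hN : 1 ≤ N) :
    (χ.LFunction 1).re ≤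
      (1 - β) * ∑ n ∈ Ioc 0 N, charDivisorSum χ n / n + 10 * q / (Nat.sqrt N : ℕ) := by
  -- notation
  set D : ℕ := Nat.sqrt N with hDdef
  set A : ℝ := ∑ e ∈ Icc 1 D, (e : ℝ) ^ (-β) with hAdef
  set Lam1 : ℝ := ∑ d ∈ Icc 1 D, (χ (d : ZMod q)).re / d with hLam1
  set G : ℝ := ∑ n ∈ Icc 1 N, (χ.zetaMul n).re * (n : ℝ) ^ (-β) with hG
  set Sig : ℝ := ∑ n ∈ Ioc 0 N, charDivisorSum χ n / n with hSig
  have h1β : 0 < 1 - β := by linarith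
  have hq1 : (1 : ℝ) ≤ q := by exact_mod_cast NeZero.one_le
  have hD1 : 1 ≤ D := Nat.le_sqrt.mpr (by simpa using hN)
  have hD0 : (0 : ℝ) < D := by exact_mod_cast hD1
  have hN0 : (0 : ℝ) < N := by exact_mod_cast hN
  have hDN2nat : D ^ 2 ≤ N := Nat.sqrt_le' N
  have hDN2 : (D : ℝ) ^ 2 ≤ N := by exact_mod_cast hDN2nat
  have hDN : (D : ℝ) ≤ N := by exact_mod_cast Nat.sqrt_le_self N
  have hNβ : 0 < (N : ℝ) ^ (1 - β) := Real.rpow_pos_of_pos hN0 _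
  -- the tree's hyperbola estimate at the zero
  have hkey := SiegelZero.abs_sum_re_zetaMul_mul_rpow_sub_main_le χ hχ hq hβ0 hβ1 hzero hN
  have hkey' : G - (N : ℝ) ^ (1 - β) / (1 - β) * Lam1 ≥
      -(2 * ((D : ℕ) : ℝ) ^ (-β) * ((q + 1) * A + q / (1 - β))) := (abs_le.mp hkey).1
  -- `A ≤ D^{1-β}/(1-β)`
  have hA : A ≤ (D : ℝ) ^ (1 - β) / (1 - β) := by
    have h := zsum_le hβ0 hβ1 D
    rwa [zsum_eq_sum_Icc] at h
  have hA0 : 0 ≤ A := sum_nonneg fun e _ => by positivity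
  -- `G ≤ N^{1-β} Sig`
  have hGle : G ≤ (N : ℝ) ^ (1 - β) * Sig := by
    rw [hG, hSig, show Finset.Icc 1 N = Finset.Ioc 0 N from rfl, mul_sum]
    refine sum_le_sum fun n hn => ?_
    have hn0 : (0 : ℝ) < n := by exact_mod_cast (mem_Ioc.mp hn).1
    have hnN : (n : ℝ) ≤ N := by exact_mod_cast (mem_Ioc.mp hn).2
    have hr : 0 ≤ charDivisorSum χ n := charDivisorSum_nonneg χ hq n
    have hpow : (n : ℝ) ^ (-β) ≤ (N : ℝ) ^ (1 - β) / n := by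
      rw [show (n : ℝ) ^ (-β) = (n : ℝ) ^ (1 - β) / n by
        rw [eq_div_iff hn0.ne', ← Real.rpow_add_one hn0.ne']; ring_nf]
      exact div_le_div_of_nonneg_right (Real.rpow_le_rpow hn0.le hnN h1β.le) hn0.le
    rw [← charDivisorSum_eq_zetaMul_re χ hq n]
    calc charDivisorSum χ n * (n : ℝ) ^ (-β) ≤ charDivisorSum χ n * ((N : ℝ) ^ (1 - β) / n) :=
          mul_le_mul_of_nonneg_left hpow hr
      _ = (N : ℝ) ^ (1 - β) * (charDivisorSum χ n / n) := by ring
  -- the error term: `2 D^{-β} ((q+1) A + q/(1-β)) ≤ (2(q+1)/(1-β)) (D^{1-2β} + D^{-β})`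
  have hE : 2 * (D : ℝ) ^ (-β) * ((q + 1) * A + q / (1 - β)) ≤
      2 * (q + 1) / (1 - β) * ((D : ℝ) ^ (1 - 2 * β) + (D : ℝ) ^ (-β)) := by
    have hD12 : (D : ℝ) ^ (-β) * (D : ℝ) ^ (1 - β) = (D : ℝ) ^ (1 - 2 * β) := by
      rw [← Real.rpow_add hD0]; ring_nf
    have hDβ : 0 ≤ (D : ℝ) ^ (-β) := by positivity
    calc 2 * (D : ℝ) ^ (-β) * ((q + 1) * A + q / (1 - β))
        ≤ 2 * (D : ℝ) ^ (-β) * ((q + 1) * ((D : ℝ) ^ (1 - β) / (1 - β)) + (q + 1) / (1 - β)) := by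
          gcongr
          · linarith
      _ = 2 * (q + 1) / (1 - β) * ((D : ℝ) ^ (-β) * (D : ℝ) ^ (1 - β) + (D : ℝ) ^ (-β)) := by
          ring
      _ = 2 * (q + 1) / (1 - β) * ((D : ℝ) ^ (1 - 2 * β) + (D : ℝ) ^ (-β)) := by rw [hD12]
  -- combine: `N^{1-β}/(1-β) Lam1 ≤ N^{1-β} Sig + (2(q+1)/(1-β)) (D^{1-2β} + D^{-β})`
  have hmain : (N : ℝ) ^ (1 - β) / (1 - β) * Lam1 ≤
      (N : ℝ) ^ (1 - β) * Sig + 2 * (q + 1) / (1 - β) * ((D : ℝ) ^ (1 - 2 * β) + (D : ℝ) ^ (-β)) := by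
    linarith [hkey', hGle, hE]
  -- divide by `N^{1-β}/(1-β)` and use the two exponent inequalities
  have hLam1le : Lam1 ≤ (1 - β) * Sig + 8 * q / D := by
    have hpos : 0 < (N : ℝ) ^ (1 - β) / (1 - β) := div_pos hNβ h1β
    have h := (le_div_iff₀' hpos).mpr hmain
    refine h.trans ?_
    have hsplit : ((N : ℝ) ^ (1 - β) * Sig +
        2 * (q + 1) / (1 - β) * ((D : ℝ) ^ (1 - 2 * β) + (D : ℝ) ^ (-β))) / ((N : ℝ) ^ (1 - β) / (1 - β)) =
        (1 - β) * Sig + 2 * (q + 1) *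
          (((D : ℝ) ^ (1 - 2 * β) + (D : ℝ) ^ (-β)) * ((N : ℝ) ^ (1 - β))⁻¹) := by
      field_simp
    rw [hsplit]
    have hinv : ((N : ℝ) ^ (1 - β))⁻¹ = (N : ℝ) ^ (β - 1) := by
      rw [← Real.rpow_neg hN0.le]; ring_nf
    rw [hinv, add_mul]
    have e1 := rpow_one_sub_two_mul_mul_rpow_le (β := β) hD0 hDN2 hβ1.le
    have e2 := rpow_neg_mul_rpow_le (β := β) hD0 hDN hβ1.le
    have hq2 : (q : ℝ) + 1 ≤ 2 * q := by linarith
    calc (1 - β) * Sig + 2 * (q + 1) * ((D : ℝ) ^ (1 - 2 * β) * (N : ℝ) ^ (β - 1) +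
          (D : ℝ) ^ (-β) * (N : ℝ) ^ (β - 1))
        ≤ (1 - β) * Sig + 2 * (q + 1) * ((D : ℝ)⁻¹ + (D : ℝ)⁻¹) := by gcongr
      _ = (1 - β) * Sig + 4 * (q + 1) / D := by ring
      _ ≤ (1 - β) * Sig + 4 * (2 * q) / D := by gcongr
      _ = (1 - β) * Sig + 8 * q / D := by ring
  -- `L(1, χ) ≤ Lam1 + 2q/D`
  have hL₁ : (χ.LFunction 1).re ≤ Lam1 + 2 * q / D := by
    have h := abs_re_LFunction_one_sub_sum_floor_le χ hχ hq hD0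
    rw [Nat.floor_natCast] at h
    have hbridge : ∑ n ∈ Ioc 0 D, reChar χ n / n = Lam1 := by
      rw [hLam1, show Finset.Icc 1 D = Finset.Ioc 0 D from rfl]
      refine sum_congr rfl fun n hn => ?_
      rw [reChar_apply χ (Nat.ne_of_gt (mem_Ioc.mp hn).1)]
    rw [hbridge] at h
    linarith [(abs_le.mp h).2]
  have e : 2 * (q : ℝ) / D + 8 * q / D = 10 * q / D := by ring
  linarith

/-- **`L(1, χ)` against a truncated Euler product at the scale of an exceptional zero**: for a
quadratic `χ ≠ χ₀` mod `q`, `0 < β < 1` with `L(β, χ) = 0`, and `N ≥ 1`,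
`L(1, χ) ≤ (1 − β) ∏_{p ≤ N} ((1 − 1/p)(1 − χ(p)/p))⁻¹ + 10 q/⌊√N⌋`.
[cite: DavenportMNT1980, Ch. 14] -/
theorem re_LFunction_one_le_prod_of_zero (hχ : χ ≠ 1) (hq : χ ^ 2 = 1) {β : ℝ} (hβ0 : 0 < β)
    (hβ1 : β < 1) (hzero : χ.LFunction β = 0) {N : ℕ} (hN : 1 ≤ N) :
    (χ.LFunction 1).re ≤
      (1 - β) * ∏ p ∈ Nat.primesBelow (N + 1), ((1 - (p : ℝ)⁻¹) * (1 - reChar χ p / p))⁻¹ +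
        10 * q / (Nat.sqrt N : ℕ) := by
  have h1 := re_LFunction_one_le_of_zero χ hχ hq hβ0 hβ1 hzero hN
  have h2 := sum_charDivisorSum_div_le_prod χ hq N
  have h1β : 0 ≤ 1 - β := by linarith
  nlinarith [mul_le_mul_of_nonneg_left h2 h1β]

end Literature.NumberTheory.LFunctions.RealChar
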